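import Mathlib
import HarnessLib
import Literature.RepresentationTheory.CompactGroups.WeylIntegralFormula
import Summits.Ventures.LatticeQCDFlow.Exactness.SpectralCouplingLayerExactness

/-!
# The spectral coupling layer's exactness, conditional on the NAMED Weyl integral formula

HONEST FRAMING: exact (Metropolis-corrected) sampling algorithms for lattice gauge theory;
figures of merit are autocorrelation/cost numbers at stated couplings and volumes; no
continuum-physics claim.

Venture `LatticeQCDFlow` (cell pub-lqcd), topic `Exactness`; FANOUT row 10 (`eng-equiv`).  NEW WORK
of the cell: `SpectralCouplingLayerExactness.lean` restated with its presentation hypothesis `hW`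
replaced by the tree's NAMED FACT `Literature.RepresentationTheory.CompactGroups.
weylIntegralFormula_{specialUnitary,unitary}` (Weyl's integral formula, Bröcker–tom Dieck IV
(1.11), [cite]d there, NOT proved in the tree) — so the result is CONDITIONAL on exactly that
named fact (its trust base), plus the per-link torus Jacobians of the box flow which remain
explicit hypotheses.  Nothing else is assumed; no number; no definition is introduced.

* **`hasJacobian_spectralCouplingLayer_specialUnitary_of_weylFact`** — `SU(n)`;
* **`hasJacobian_spectralCouplingLayer_unitary_of_weylFact`** — `U(n)`.
-/

noncomputable section

namespace Summit.Ventures.LatticeQCDFlow.Exactness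

open MeasureTheory Matrix Topology
open Literature.LinearAlgebra.Matrix
open Literature.MathematicalPhysics.QuantumFieldTheory
open Literature.RepresentationTheory.CompactGroups
open scoped ENNReal

variable {n : Type} [Fintype n] [DecidableEq n]

/-- **`SU(n)` spectral coupling layer: exact transport of product Haar with the booked density,
CONDITIONAL on the named fact `weylIntegralFormula_specialUnitary n`** (and the per-link torus
Jacobians `hfJ` with Boyda's identity `hJ`). -/
theorem hasJacobian_spectralCouplingLayer_specialUnitary_of_weylFact {ι : Type*} [Fintype ι]
    (hW : weylIntegralFormula_specialUnitary n)
    (p : ι → Prop) [DecidablePred p]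
    (S : {i // p i} → ({i // ¬p i} → Matrix.specialUnitaryGroup n ℂ) → Matrix.specialUnitaryGroup n ℂ)
    (hS : ∀ a, Continuous (S a))
    (f : {i // p i} → ({i // ¬p i} → Matrix.specialUnitaryGroup n ℂ) → (n → ℂ) → (n → ℂ))
    (hf : ∀ a, ContinuousOn
      (fun q : ({i // ¬p i} → Matrix.specialUnitaryGroup n ℂ) × (n → ℂ) => f a q.1 q.2)
      {q | ∀ i, ‖q.2 i‖ = 1})
    (h : {i // p i} → ({i // ¬p i} → Matrix.specialUnitaryGroup n ℂ) →
      Matrix.specialUnitaryGroup n ℂ → Matrix.specialUnitaryGroup n ℂ)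
    (hagree : ∀ a y (P : Matrix.specialUnitaryGroup n ℂ) (V : Matrix n n ℂ) (d : n → ℂ),
      V ∈ Matrix.unitaryGroup n ℂ → (P : Matrix n n ℂ) = V * diagonal d * star V →
        ((h a y P : Matrix.specialUnitaryGroup n ℂ) : Matrix n n ℂ) = V * diagonal (f a y d) * star V)
    (fT : {i // p i} → ({i // ¬p i} → Matrix.specialUnitaryGroup n ℂ) →
      specialDiagonalTorus n → specialDiagonalTorus n)
    (hfT : ∀ a y (t : specialDiagonalTorus n),
      ((fT a y t : Matrix.specialUnitaryGroup n ℂ) : Matrix n n ℂ) =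
        diagonal (f a y fun i => ((t : Matrix.specialUnitaryGroup n ℂ) : Matrix n n ℂ) i i))
    (JfT : {i // p i} → ({i // ¬p i} → Matrix.specialUnitaryGroup n ℂ) → specialDiagonalTorus n → ℝ≥0∞)
    (hfJ : ∀ a y, HasJacobian (haarProbability (specialDiagonalTorus n)) (fT a y) (JfT a y))
    (j : {i // p i} → ({i // ¬p i} → Matrix.specialUnitaryGroup n ℂ) → Matrix.specialUnitaryGroup n ℂ → ℝ)
    (hjc : ∀ a, Continuous
      fun q : ({i // ¬p i} → Matrix.specialUnitaryGroup n ℂ) × Matrix.specialUnitaryGroup n ℂ =>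
        j a q.1 q.2)
    (hj0 : ∀ a y g, 0 ≤ j a y g)
    (hJ : ∀ a y (g : Matrix.specialUnitaryGroup n ℂ) (t : specialDiagonalTorus n),
      ENNReal.ofReal (j a y (g * (t : Matrix.specialUnitaryGroup n ℂ) * g⁻¹)) * ENNReal.ofReal
          ((∏ i, ∏ k ∈ Finset.univ.erase i,
            ‖((t : Matrix.specialUnitaryGroup n ℂ) : Matrix n n ℂ) i i -
              ((t : Matrix.specialUnitaryGroup n ℂ) : Matrix n n ℂ) k k‖) / (Fintype.card n).factorial) =
        JfT a y t * ENNReal.ofReal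
          ((∏ i, ∏ k ∈ Finset.univ.erase i,
            ‖((fT a y t : Matrix.specialUnitaryGroup n ℂ) : Matrix n n ℂ) i i -
              ((fT a y t : Matrix.specialUnitaryGroup n ℂ) : Matrix n n ℂ) k k‖) / (Fintype.card n).factorial)) :
    HasJacobian (Measure.pi fun _ : ι => haarProbability (Matrix.specialUnitaryGroup n ℂ))
      (Theory2.coupleFun p fun a y u => h a y (u * S a y) * (u * S a y)⁻¹ * u)
      fun U => ENNReal.ofReal (Theory2.coupleJac p (fun a y u => j a y (u * S a y)) U) :=
  hasJacobian_spectralCouplingLayer_of_weyl_specialUnitary hW p S hS f hf h hagree fT hfT JfT hfJ j hjc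
    hj0 hJ

/-- **`U(n)` spectral coupling layer: exact transport of product Haar with the booked density,
CONDITIONAL on the named fact `weylIntegralFormula_unitary n`.** -/
theorem hasJacobian_spectralCouplingLayer_unitary_of_weylFact {ι : Type*} [Fintype ι]
    (hW : weylIntegralFormula_unitary n)
    (p : ι → Prop) [DecidablePred p]
    (S : {i // p i} → ({i // ¬p i} → Matrix.unitaryGroup n ℂ) → Matrix.unitaryGroup n ℂ)
    (hS : ∀ a, Continuous (S a))
    (f : {i // p i} → ({i // ¬p i} → Matrix.unitaryGroup n ℂ) → (n → ℂ) → (n → ℂ))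
    (hf : ∀ a, ContinuousOn
      (fun q : ({i // ¬p i} → Matrix.unitaryGroup n ℂ) × (n → ℂ) => f a q.1 q.2)
      {q | ∀ i, ‖q.2 i‖ = 1})
    (h : {i // p i} → ({i // ¬p i} → Matrix.unitaryGroup n ℂ) →
      Matrix.unitaryGroup n ℂ → Matrix.unitaryGroup n ℂ)
    (hagree : ∀ a y (P : Matrix.unitaryGroup n ℂ) (V : Matrix n n ℂ) (d : n → ℂ),
      V ∈ Matrix.unitaryGroup n ℂ → (P : Matrix n n ℂ) = V * diagonal d * star V →
        ((h a y P : Matrix.unitaryGroup n ℂ) : Matrix n n ℂ) = V * diagonal (f a y d) * star V)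
    (fT : {i // p i} → ({i // ¬p i} → Matrix.unitaryGroup n ℂ) → diagonalTorus n → diagonalTorus n)
    (hfT : ∀ a y (t : diagonalTorus n),
      ((fT a y t : Matrix.unitaryGroup n ℂ) : Matrix n n ℂ) =
        diagonal (f a y fun i => ((t : Matrix.unitaryGroup n ℂ) : Matrix n n ℂ) i i))
    (JfT : {i // p i} → ({i // ¬p i} → Matrix.unitaryGroup n ℂ) → diagonalTorus n → ℝ≥0∞)
    (hfJ : ∀ a y, HasJacobian (haarProbability (diagonalTorus n)) (fT a y) (JfT a y))
    (j : {i // p i} → ({i // ¬p i} → Matrix.unitaryGroup n ℂ) → Matrix.unitaryGroup n ℂ → ℝ)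
    (hjc : ∀ a, Continuous
      fun q : ({i // ¬p i} → Matrix.unitaryGroup n ℂ) × Matrix.unitaryGroup n ℂ => j a q.1 q.2)
    (hj0 : ∀ a y g, 0 ≤ j a y g)
    (hJ : ∀ a y (g : Matrix.unitaryGroup n ℂ) (t : diagonalTorus n),
      ENNReal.ofReal (j a y (g * (t : Matrix.unitaryGroup n ℂ) * g⁻¹)) * ENNReal.ofReal
          ((∏ i, ∏ k ∈ Finset.univ.erase i,
            ‖((t : Matrix.unitaryGroup n ℂ) : Matrix n n ℂ) i i -
              ((t : Matrix.unitaryGroup n ℂ) : Matrix n n ℂ) k k‖) / (Fintype.card n).factorial) =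
        JfT a y t * ENNReal.ofReal
          ((∏ i, ∏ k ∈ Finset.univ.erase i,
            ‖((fT a y t : Matrix.unitaryGroup n ℂ) : Matrix n n ℂ) i i -
              ((fT a y t : Matrix.unitaryGroup n ℂ) : Matrix n n ℂ) k k‖) / (Fintype.card n).factorial)) :
    HasJacobian (Measure.pi fun _ : ι => haarProbability (Matrix.unitaryGroup n ℂ))
      (Theory2.coupleFun p fun a y u => h a y (u * S a y) * (u * S a y)⁻¹ * u)
      fun U => ENNReal.ofReal (Theory2.coupleJac p (fun a y u => j a y (u * S a y)) U) :=
  hasJacobian_spectralCouplingLayer_of_weyl_unitary hW p S hS f hf h hagree fT hfT JfT hfJ j hjc hj0 hJ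

end Summit.Ventures.LatticeQCDFlow.Exactness
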